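import Literature.Probability.LatticeModels.DobrushinMetricInfiniteRangeInfluence
import Summits.Ventures.YMGap.RobustBall.BoundaryDecaySummableSU2
import Summits.Ventures.YMGap.RobustBall.ConcentrationKR
import HarnessLib

/-!
# Venture YMGap, track ROBUST-BALL — GAUSSIAN CONCENTRATION, TIER 2: single-link boundary influences and McDiarmid bounds
# for SUMMABLE (infinite-range) members, any volume, any boundary field, every DLR state

HONEST FRAMING. WHAT THIS IS: a venture file (cell `pub-ymgap`, track Y2 ROBUST-BALL, seat ds-3, theorems only), the TIER-2 twin of
`ConcentrationKR.lean` (object «C-CONC-S»). A tier-2 member is `N β S_W + W` with `W` ANY link potential on `ℤ^d` with continuous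
own-link terms and a summable majorant (specification `perturbedYMS`); its Dobrushin matrix has SUMMABLE rows, so the geometric
super-solution of tier 1 (`ConcentrationKR.abs_kernel_sub_kernel_le_of_isKRContraction`, finite `nbr`) is replaced by the Literature's
infinite-range window comparison `DobrushinMetric.abs_kernel_sub_kernel_le_of_summable_exp` (Dobrushin 1970 Thm. 3 / Föllmer 1988 (2.8),
(2.10), Cor. (2.14), from the estimate `R·𝟙_Λ + r(ω_y,η_y)·𝟙_y`). Throughout, the member satisfies rb-p1's weighted row condition
`6(d−1)|β| e^{a} e^{t} √(c v) + e^{a/2} √c Λ_t < 1` (the hypothesis of `perturbedMassGapS_SU`, same loads, same one-link pair; the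
section variables `hc … hρ`):
* ★★ `abs_kernelS_sub_kernelS_le` — SINGLE-LINK BOUNDARY INFLUENCE: for every finite link volume `Λ`, every link `y ∉ Λ`, boundary
  fields `ω = η` off `y`, and every Lipschitz cylinder `F` (constant `K`, links `Δ`):
  `|∫ F dγ^{W,S}_Λ(·|ω) − ∫ F dγ^{W,S}_Λ(·|η)| ≤ 2√N · K · Σ_{z ∈ Δ} e^{−t ‖z − y‖_∞}`; finite sums `abs_kernelS_sub_kernelS_sum_le`;
* `kernelS_sum_ge_le` — finite volume, ANY boundary field: `γ^{W,S}_Λ({ΣF − ∫ΣF dγ ≥ r}|η) ≤ exp(−2r²/V)` for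
  `V ≥ Σ_{y ∈ Λ} (Σ_i c_{F_i}(y))²`, `c_{F}(y) = 2√N K Σ_{z ∈ Δ} e^{−t‖z − y‖_∞}` (g13's generic McDiarmid–Azuma for specifications);
* `dlrS_sum_ge_kernel_integral_le` — every DLR state about the conditional mean, same bound;
* `abs_boxS_sum_sub_integral_le` — the box rate `(Σ_i 2√N K_i #Δ_i) e^{−t(n−m)}` of a finite sum, uniformly in the boundary field;
* ★★ `dlrS_sum_abs_sub_integral_ge_le` — GAUSSIAN CONCENTRATION IN INFINITE VOLUME for every DLR state of the member:
  box proxies `≤ V` ⇒ `μ{|ΣF − ∫ΣF dμ| ≥ r} ≤ 2 exp(−2r²/V)`.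
WHAT THIS IS NOT: strong-coupling LATTICE statements inside the tier-2 ball; upper tail bounds with LOSSY explicit constants (`ℓ¹`
comparison); not an LDP, not a CLT; nothing about the continuum limit or the Clay Millennium problem.

References: C. McDiarmid, *Surveys in Combinatorics* (1989) 148–188; C. Külske, CMP 239 (2003) 29–51 (concentration under Dobrushin
uniqueness); R. L. Dobrushin, Theory Probab. Appl. 15 (1970), Thm. 3; H. Föllmer, LNM 1362 (1988), Ch. I, (2.8), (2.10), Cor. (2.14);
the Literature's `DobrushinMetricInfiniteRangeInfluence.lean`; the seat's `SpecificationConcentration(Gibbs).lean`, `ConcentrationKR.lean`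
(tier 1), `BoundaryDecaySummable.lean`.
-/

noncomputable section

open MeasureTheory Filter Function ProbabilityTheory Real Topology
open scoped NNReal
open Literature.Probability.LatticeModels
open Literature.Probability.LatticeModels.DobrushinMetric
open Literature.MathematicalPhysics.QuantumLattice
open Literature.MathematicalPhysics.QuantumFieldTheory hiding ZdEdge

namespace Summit.Ventures.YMGap.RobustBall

section SUN

variable {d N : ℕ} {ι : Type*}
variable {W : Potential (ZdEdge d) (Matrix.specialUnitaryGroup (Fin N) ℂ)} {B : Finset (ZdEdge d) → ℝ}
variable (hd : 1 ≤ d) (hN : 1 ≤ N) {β b c v a Λt t : ℝ}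
  (hc : 0 ≤ c) (hv : 0 ≤ v) (hb : |β| * (2 * ((d : ℝ) - 1)) ≤ b)
  (hP : ∀ B : Matrix (Fin N) (Fin N) ℂ, matrixOpNorm B ≤ b →
    ∀ (ψ : Matrix.specialUnitaryGroup (Fin N) ℂ → ℝ) (M : ℝ), 0 ≤ M →
      (∀ x y, |ψ x - ψ y| ≤ M * suFrobDist x y) →
      Var[ψ; (haarProbability (Matrix.specialUnitaryGroup (Fin N) ℂ)).tilted
        fun g => (N : ℝ) * ((g : Matrix (Fin N) (Fin N) ℂ) * B).trace.re] ≤ c * M ^ 2)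
  (hVB : ∀ B : Matrix (Fin N) (Fin N) ℂ, matrixOpNorm B ≤ b → ∀ Δ : Matrix (Fin N) (Fin N) ℂ,
    Var[fun g : Matrix.specialUnitaryGroup (Fin N) ℂ =>
        (N : ℝ) * ((g : Matrix (Fin N) (Fin N) ℂ) * Δ).trace.re;
      (haarProbability (Matrix.specialUnitaryGroup (Fin N) ℂ)).tilted
        fun g => (N : ℝ) * ((g : Matrix (Fin N) (Fin N) ℂ) * B).trace.re] ≤ v * frobNorm Δ ^ 2)
  (h : IsLinkSummable W B) (hWc : ∀ X, Continuous (W X))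
  (hWdep : ∀ X, DependsOn (W X) (↑X : Set (ZdEdge d)))
  {osc : Finset (ZdEdge d) → ZdEdge d → ℝ} (hosc : ∀ X, Dobrushin.IsOscBound (W X) (osc X))
  (hoscs : ∀ e, Summable fun X : Finset (ZdEdge d) => (if e ∈ X then osc X e else 0))
  (hosca : ∀ e, ∑' X : Finset (ZdEdge d), (if e ∈ X then osc X e else 0) ≤ a)
  {lip : Finset (ZdEdge d) → ZdEdge d → ℝ} (hlip : ∀ X, IsLipBound suFrobDist (W X) (lip X))
  {ℓ : ZdEdge d → ZdEdge d → ℝ}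
  (hlips : ∀ e y, Summable fun X : Finset (ZdEdge d) => (if e ∈ X ∧ y ∈ X then lip X y else 0))
  (hℓ : ∀ e y, y ≠ e → ∑' X : Finset (ZdEdge d), (if e ∈ X ∧ y ∈ X then lip X y else 0) ≤ ℓ e y)
  (ht : 0 ≤ t) (hℓs : ∀ e, Summable fun y => (if y = e then 0 else ℓ e y) * exp (t * ‖e.1 - y.1‖))
  (hℓt : ∀ e, ∑' y, (if y = e then 0 else ℓ e y) * exp (t * ‖e.1 - y.1‖) ≤ Λt)
  (hρ : 6 * ((d : ℝ) - 1) * |β| * (exp a * exp t * Real.sqrt (c * v)) + exp (a / 2) * Real.sqrt c * Λt < 1)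

include hd hN hc hv hb hP hVB h hWc hWdep hosc hoscs hosca hlip hlips hℓ ht hℓs hℓt hρ

/-- ★★ **TIER 2: THE SINGLE-LINK BOUNDARY INFLUENCE OF A SUMMABLE MEMBER'S KERNELS** (Dobrushin 1970, Thm. 3; Föllmer 1988, Ch. I,
(2.8)/(2.10) with Cor. (2.14)). Under rb-p1's weighted row condition, for every finite link volume `Λ`, every link `y ∉ Λ`, every two
boundary fields `ω, η` agreeing off `y`, and every Lipschitz cylinder `F` (constant `K`, links `Δ`):
`|∫ F dγ^{W,S}_Λ(·|ω) − ∫ F dγ^{W,S}_Λ(·|η)| ≤ 2√N · K · Σ_{z ∈ Δ} e^{−t ‖z − y‖_∞}` — the influence of one boundary link decays at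
the rate `t` of the Dobrushin weight, uniformly in the volume. [folklore] -/
theorem abs_kernelS_sub_kernelS_le (Λ : Finset (ZdEdge d)) {y : ZdEdge d} (hy : y ∉ Λ)
    {ω η : LGConfig d (Matrix.specialUnitaryGroup (Fin N) ℂ)} (hωη : ∀ z, z ≠ y → ω z = η z)
    {F : LGConfig d (Matrix.specialUnitaryGroup (Fin N) ℂ) → ℝ} {Δ : Finset (ZdEdge d)} {K : ℝ≥0}
    (hF : IsLipschitzCylinder (fundamentalRep (Fin N)) F Δ K) :
    |(∫ U, F U ∂(perturbedYMS (d := d) (fundamentalRep (Fin N)) (N * β) W Λ ω)) -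
        ∫ U, F U ∂(perturbedYMS (d := d) (fundamentalRep (Fin N)) (N * β) W Λ η)| ≤
      2 * Real.sqrt N * K * ∑ z ∈ Δ, exp (-(t * ‖z.1 - y.1‖)) := by
  classical
  haveI : SecondCountableTopology (Matrix (Fin N) (Fin N) ℂ) :=
    inferInstanceAs (SecondCountableTopology (Fin N → Fin N → ℂ))
  haveI : SecondCountableTopology (Matrix.specialUnitaryGroup (Fin N) ℂ) :=
    Topology.IsEmbedding.subtypeVal.secondCountableTopology
  have hγ : IsSpecification (perturbedYMS (d := d) (fundamentalRep (Fin N)) (N * β) W) :=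
    isSpecification_perturbedYMS _ (continuous_fundamentalRep (Fin N)) _ h hWc hWdep
  have hℓ0 : ∀ x y, y ≠ x → 0 ≤ ℓ x y := fun x y hyx => by
    refine le_trans (tsum_nonneg fun X => ?_) (hℓ x y hyx)
    split_ifs
    · exact (hlip X).nonneg y
    · exact le_rfl
  have hrow := fun x => summable_coeffS_row₀ (β := β) (c := c) (v := v) (a := a) hd hℓ0 ht hℓs hℓt x
  have hℓs' : ∀ e, Summable fun y => (if y = e then 0 else ℓ e y) := fun e =>
    Summable.of_nonneg_of_le (fun y => by split_ifs with hye; exacts [le_rfl, hℓ0 e y hye])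
      (fun y => le_mul_of_one_le_right (by split_ifs with hye; exacts [le_rfl, hℓ0 e y hye])
        (one_le_exp (by positivity))) (hℓs e)
  have hC0 : ∀ x y : ZdEdge d, 0 ≤ (if y = x then 0 else
      (exp a * Real.sqrt (c * v) * |β| * linkInfluence x y + exp (a / 2) * Real.sqrt c * ℓ x y)) :=
    fun x y => by
      split_ifs with hyx
      · exact le_rfl
      · exact add_nonneg (by positivity) (mul_nonneg (by positivity) (hℓ0 x y hyx))
  have hρ0 : 0 ≤ 6 * ((d : ℝ) - 1) * |β| * (exp a * exp t * Real.sqrt (c * v)) + exp (a / 2) * Real.sqrt c * Λt := by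
    have hd0 : 0 < d := hd
    let e₀ : ZdEdge d := (0, ⟨0, hd0⟩)
    exact (tsum_nonneg (hC0 e₀)).trans (hrow e₀).2.2.1
  have hRsqrt : (0 : ℝ) ≤ 2 * Real.sqrt N := by positivity
  have hK : (0 : ℝ) ≤ K := K.2
  have key := abs_kernel_sub_kernel_le_of_summable_exp hγ (fun _ _ => suFrobDist_nonneg _ _) suFrobDist_le hRsqrt
    suFrobDist_self hC0 (fun x => (hrow x).1)
    (fun x ω' η' φ L hφm hφb hL hφL => abs_integral_siteLaw_perturbedYMS_sub_le_tsum₀ hd hN hc hv hb hP hVB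
      h hWc hWdep hosc hoscs hosca hlip hlips hℓ hℓs' x ω' η' φ L hφm hφb hL hφL)
    Λ hρ0 hρ (fun x z : ZdEdge d => ‖x.1 - z.1‖) (fun _ _ => norm_nonneg _) (fun x => by simp)
    (fun x z w => norm_sub_le_norm_sub_add_norm_sub x.1 z.1 w.1) ht
    (fun x _ => (hrow x).2.1) (fun x _ => (hrow x).2.2.2) hy hωη hF.measurable hF.dependsOn hF.abs_le
    (hF.isLipBound zero_le_one (fun a b => by rw [one_mul]; exact dist_suEntries_le_suFrobDist a b))
  refine key.trans ?_
  have hsum : ∑ z ∈ Δ, exp (-(t * ‖z.1 - y.1‖)) * (if z ∈ Δ then 1 * (K : ℝ) else 0) =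
      K * ∑ z ∈ Δ, exp (-(t * ‖z.1 - y.1‖)) := by
    rw [Finset.mul_sum]
    exact Finset.sum_congr rfl fun z hz => by rw [if_pos hz]; ring
  rw [hsum]
  have hS0 : 0 ≤ (K : ℝ) * ∑ z ∈ Δ, exp (-(t * ‖z.1 - y.1‖)) :=
    mul_nonneg hK (Finset.sum_nonneg fun z _ => (exp_pos _).le)
  calc suFrobDist (ω y) (η y) * ((K : ℝ) * ∑ z ∈ Δ, exp (-(t * ‖z.1 - y.1‖)))
      ≤ 2 * Real.sqrt N * ((K : ℝ) * ∑ z ∈ Δ, exp (-(t * ‖z.1 - y.1‖))) :=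
        mul_le_mul_of_nonneg_right (suFrobDist_le _ _) hS0
    _ = 2 * Real.sqrt N * K * ∑ z ∈ Δ, exp (-(t * ‖z.1 - y.1‖)) := by ring

/-- **Single-link boundary influence of a finite sum of Lipschitz cylinders, tier 2**: for `y ∉ Λ` and `ω = η` off `y`,
`|∫ Σ_i F_i dγ^{W,S}_Λ(·|ω) − ∫ Σ_i F_i dγ^{W,S}_Λ(·|η)| ≤ Σ_i 2√N · K_i · Σ_{z ∈ Δ_i} e^{−t ‖z − y‖_∞}`. [folklore] -/
theorem abs_kernelS_sub_kernelS_sum_le (Λ : Finset (ZdEdge d)) {y : ZdEdge d} (hy : y ∉ Λ)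
    {ω η : LGConfig d (Matrix.specialUnitaryGroup (Fin N) ℂ)} (hωη : ∀ z, z ≠ y → ω z = η z)
    (s : Finset ι) {F : ι → LGConfig d (Matrix.specialUnitaryGroup (Fin N) ℂ) → ℝ} {Δ : ι → Finset (ZdEdge d)}
    {K : ι → ℝ≥0} (hF : ∀ i ∈ s, IsLipschitzCylinder (fundamentalRep (Fin N)) (F i) (Δ i) (K i)) :
    |(∫ U, ∑ i ∈ s, F i U ∂(perturbedYMS (d := d) (fundamentalRep (Fin N)) (N * β) W Λ ω)) -
        ∫ U, ∑ i ∈ s, F i U ∂(perturbedYMS (d := d) (fundamentalRep (Fin N)) (N * β) W Λ η)| ≤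
      ∑ i ∈ s, 2 * Real.sqrt N * K i * ∑ z ∈ Δ i, exp (-(t * ‖z.1 - y.1‖)) := by
  haveI : SecondCountableTopology (Matrix (Fin N) (Fin N) ℂ) :=
    inferInstanceAs (SecondCountableTopology (Fin N → Fin N → ℂ))
  haveI : SecondCountableTopology (Matrix.specialUnitaryGroup (Fin N) ℂ) :=
    Topology.IsEmbedding.subtypeVal.secondCountableTopology
  have hγ : IsSpecification (perturbedYMS (d := d) (fundamentalRep (Fin N)) (N * β) W) :=
    isSpecification_perturbedYMS _ (continuous_fundamentalRep (Fin N)) _ h hWc hWdep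
  haveI := hγ.isProbability Λ ω
  haveI := hγ.isProbability Λ η
  have hint : ∀ (ξ : LGConfig d (Matrix.specialUnitaryGroup (Fin N) ℂ)), ∀ i ∈ s,
      Integrable (F i) (perturbedYMS (d := d) (fundamentalRep (Fin N)) (N * β) W Λ ξ) := fun ξ i hi => by
    haveI := hγ.isProbability Λ ξ
    exact integrable_of_abs_le' (hF i hi).measurable (hF i hi).abs_le
  rw [integral_finsetSum s (hint ω), integral_finsetSum s (hint η), ← Finset.sum_sub_distrib]
  refine (Finset.abs_sum_le_sum_abs _ _).trans (Finset.sum_le_sum fun i hi => ?_)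
  exact abs_kernelS_sub_kernelS_le hd hN hc hv hb hP hVB h hWc hWdep hosc hoscs hosca hlip hlips hℓ ht hℓs hℓt hρ Λ hy hωη
    (hF i hi)

/-- **Finite volume, any boundary field, finite sums, tier 2**: for `V ≥ Σ_{y ∈ Λ} (Σ_i 2√N K_i Σ_{z ∈ Δ_i} e^{−t‖z − y‖})²` and `r ≥ 0`,
`γ^{W,S}_Λ({ΣF − ∫ ΣF dγ^{W,S}_Λ(·|η) ≥ r} | η) ≤ exp(−2 r² / V)` (McDiarmid–Azuma for the kernels of a specification, g13's
`SpecConcentration.measureReal_kernel_ge_le_of_le`). [folklore] -/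
theorem kernelS_sum_ge_le (s : Finset ι) {F : ι → LGConfig d (Matrix.specialUnitaryGroup (Fin N) ℂ) → ℝ}
    {Δ : ι → Finset (ZdEdge d)} {K : ι → ℝ≥0} (hF : ∀ i ∈ s, IsLipschitzCylinder (fundamentalRep (Fin N)) (F i) (Δ i) (K i))
    (Λ : Finset (ZdEdge d)) {Vc : ℝ}
    (hV : ∑ y ∈ Λ, (∑ i ∈ s, 2 * Real.sqrt N * K i * ∑ z ∈ Δ i, exp (-(t * ‖z.1 - y.1‖))) ^ 2 ≤ Vc)
    (η : LGConfig d (Matrix.specialUnitaryGroup (Fin N) ℂ)) {r : ℝ} (hr : 0 ≤ r) :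
    (perturbedYMS (d := d) (fundamentalRep (Fin N)) (N * β) W Λ η).real
        {U | r ≤ (∑ i ∈ s, F i U) - ∫ U', ∑ i ∈ s, F i U' ∂(perturbedYMS (d := d) (fundamentalRep (Fin N)) (N * β) W Λ η)} ≤
      exp (-2 * r ^ 2 / Vc) := by
  haveI : SecondCountableTopology (Matrix (Fin N) (Fin N) ℂ) :=
    inferInstanceAs (SecondCountableTopology (Fin N → Fin N → ℂ))
  haveI : SecondCountableTopology (Matrix.specialUnitaryGroup (Fin N) ℂ) :=
    Topology.IsEmbedding.subtypeVal.secondCountableTopology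
  have hγ : IsSpecification (perturbedYMS (d := d) (fundamentalRep (Fin N)) (N * β) W) :=
    isSpecification_perturbedYMS _ (continuous_fundamentalRep (Fin N)) _ h hWc hWdep
  obtain ⟨hm, hM⟩ := measurable_sum_of_isLipschitzCylinder s hF
  exact SpecConcentration.measureReal_kernel_ge_le_of_le hγ Λ hm hM
    (c := fun y => ∑ i ∈ s, 2 * Real.sqrt N * K i * ∑ z ∈ Δ i, exp (-(t * ‖z.1 - y.1‖)))
    (fun y => Finset.sum_nonneg fun i _ => by
      have hK : (0 : ℝ) ≤ K i := (K i).2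
      exact mul_nonneg (by positivity) (Finset.sum_nonneg fun z _ => (exp_pos _).le))
    (fun Λ' _ y _ hy ω η' hωη => abs_kernelS_sub_kernelS_sum_le hd hN hc hv hb hP hVB h hWc hWdep hosc hoscs hosca hlip hlips
      hℓ ht hℓs hℓt hρ Λ' hy hωη s hF)
    hV hr η

/-- **Every DLR state of the member, finite sums, about the conditional mean, tier 2**: `μ{ΣF − ∫ ΣF dγ^{W,S}_Λ(·|·) ≥ r} ≤ exp(−2 r² / V)`
for `V ≥ Σ_{y ∈ Λ} (Σ_i c_{F_i}(y))²` — no uniqueness needed. [folklore] -/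
theorem dlrS_sum_ge_kernel_integral_le (s : Finset ι) {F : ι → LGConfig d (Matrix.specialUnitaryGroup (Fin N) ℂ) → ℝ}
    {Δ : ι → Finset (ZdEdge d)} {K : ι → ℝ≥0} (hF : ∀ i ∈ s, IsLipschitzCylinder (fundamentalRep (Fin N)) (F i) (Δ i) (K i))
    (Λ : Finset (ZdEdge d)) {Vc : ℝ}
    (hV : ∑ y ∈ Λ, (∑ i ∈ s, 2 * Real.sqrt N * K i * ∑ z ∈ Δ i, exp (-(t * ‖z.1 - y.1‖))) ^ 2 ≤ Vc)
    {μ : Measure (LGConfig d (Matrix.specialUnitaryGroup (Fin N) ℂ))}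
    (hμ : μ ∈ perturbedGibbsMeasuresS (d := d) (fundamentalRep (Fin N)) (N * β) W) {r : ℝ} (hr : 0 ≤ r) :
    μ.real {U | r ≤ (∑ i ∈ s, F i U) -
        ∫ U', ∑ i ∈ s, F i U' ∂(perturbedYMS (d := d) (fundamentalRep (Fin N)) (N * β) W Λ U)} ≤
      exp (-2 * r ^ 2 / Vc) := by
  haveI : SecondCountableTopology (Matrix (Fin N) (Fin N) ℂ) :=
    inferInstanceAs (SecondCountableTopology (Fin N → Fin N → ℂ))
  haveI : SecondCountableTopology (Matrix.specialUnitaryGroup (Fin N) ℂ) :=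
    Topology.IsEmbedding.subtypeVal.secondCountableTopology
  have hγ : IsSpecification (perturbedYMS (d := d) (fundamentalRep (Fin N)) (N * β) W) :=
    isSpecification_perturbedYMS _ (continuous_fundamentalRep (Fin N)) _ h hWc hWdep
  have hμ' : IsGibbsMeasure (perturbedYMS (d := d) (fundamentalRep (Fin N)) (N * β) W) μ := hμ
  obtain ⟨hm, hM⟩ := measurable_sum_of_isLipschitzCylinder s hF
  exact SpecConcentration.measureReal_ge_kernel_integral_le hγ Λ hm hM
    (c := fun y => ∑ i ∈ s, 2 * Real.sqrt N * K i * ∑ z ∈ Δ i, exp (-(t * ‖z.1 - y.1‖)))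
    (fun y => Finset.sum_nonneg fun i _ => by
      have hK : (0 : ℝ) ≤ K i := (K i).2
      exact mul_nonneg (by positivity) (Finset.sum_nonneg fun z _ => (exp_pos _).le))
    (fun Λ' _ y _ hy ω η' hωη => abs_kernelS_sub_kernelS_sum_le hd hN hc hv hb hP hVB h hWc hWdep hosc hoscs hosca hlip hlips
      hℓ ht hℓs hℓt hρ Λ' hy hωη s hF)
    hV hμ' hr

/-- **The box rate of a finite sum, tier 2**: if every `Δ_i ⊆ boxLinks d m` then for every DLR state `μ` and every boundary field `ω`,
`|∫ ΣF dγ^{W,S}_{box n}(·|ω) − ∫ ΣF dμ| ≤ (Σ_i 2√N K_i #Δ_i) · e^{−t (n − m)}` (`abs_boundaryS_sub_integral_le`, summed). [folklore] -/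
theorem abs_boxS_sum_sub_integral_le (s : Finset ι) {F : ι → LGConfig d (Matrix.specialUnitaryGroup (Fin N) ℂ) → ℝ}
    {Δ : ι → Finset (ZdEdge d)} {K : ι → ℝ≥0} (hF : ∀ i ∈ s, IsLipschitzCylinder (fundamentalRep (Fin N)) (F i) (Δ i) (K i))
    {m : ℕ} (hΔ : ∀ i ∈ s, Δ i ⊆ boxLinks d m) (n : ℕ)
    {μ : Measure (LGConfig d (Matrix.specialUnitaryGroup (Fin N) ℂ))}
    (hμ : μ ∈ perturbedGibbsMeasuresS (d := d) (fundamentalRep (Fin N)) (N * β) W)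
    (ω : LGConfig d (Matrix.specialUnitaryGroup (Fin N) ℂ)) :
    |(∫ U, ∑ i ∈ s, F i U ∂(perturbedYMS (d := d) (fundamentalRep (Fin N)) (N * β) W (boxLinks d n) ω)) -
        ∫ U, ∑ i ∈ s, F i U ∂μ| ≤
      (∑ i ∈ s, 2 * Real.sqrt N * K i * (Δ i).card) * exp (-(t * ((n : ℝ) - m))) := by
  haveI : SecondCountableTopology (Matrix (Fin N) (Fin N) ℂ) :=
    inferInstanceAs (SecondCountableTopology (Fin N → Fin N → ℂ))
  haveI : SecondCountableTopology (Matrix.specialUnitaryGroup (Fin N) ℂ) :=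
    Topology.IsEmbedding.subtypeVal.secondCountableTopology
  have hγ : IsSpecification (perturbedYMS (d := d) (fundamentalRep (Fin N)) (N * β) W) :=
    isSpecification_perturbedYMS _ (continuous_fundamentalRep (Fin N)) _ h hWc hWdep
  have hμ' : IsGibbsMeasure (perturbedYMS (d := d) (fundamentalRep (Fin N)) (N * β) W) μ := hμ
  haveI := hμ'.isProbabilityMeasure
  haveI := hγ.isProbability (boxLinks d n) ω
  have hint1 : ∀ i ∈ s, Integrable (F i) (perturbedYMS (d := d) (fundamentalRep (Fin N)) (N * β) W (boxLinks d n) ω) :=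
    fun i hi => integrable_of_abs_le' (hF i hi).measurable (hF i hi).abs_le
  have hint2 : ∀ i ∈ s, Integrable (F i) μ := fun i hi => integrable_of_abs_le' (hF i hi).measurable (hF i hi).abs_le
  rw [integral_finsetSum s hint1, integral_finsetSum s hint2, ← Finset.sum_sub_distrib, Finset.sum_mul]
  refine (Finset.abs_sum_le_sum_abs _ _).trans (Finset.sum_le_sum fun i hi => ?_)
  exact abs_boundaryS_sub_integral_le hd hN hc hv hb hP hVB h hWc hWdep hosc hoscs hosca hlip hlips hℓ ht hℓs hℓt hρ hμ
    (boxLinks d n) ω (hF i hi) fun y hy z hz => by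
      have hy' := hΔ i hi hy
      rw [mem_boxLinks, mem_siteBox_iff_norm] at hy' hz
      have hz' : (n : ℝ) < ‖z.1‖ := lt_of_not_ge hz
      have h' := norm_sub_norm_le z.1 y.1
      rw [norm_sub_rev] at h'
      linarith

/-- ★★ **GAUSSIAN CONCENTRATION OF FINITE SUMS IN INFINITE VOLUME, TIER 2**: if the box variance proxies of the family are bounded,
`Σ_{y ∈ boxLinks d n} (Σ_i 2√N K_i Σ_{z ∈ Δ_i} e^{−t‖z − y‖_∞})² ≤ V` for every `n`, then for EVERY DLR state `μ` of the summable member and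
every `r ≥ 0`: `μ{|Σ_i F_i − ∫ Σ_i F_i dμ| ≥ r} ≤ 2 exp(−2 r² / V)` — the kernels' McDiarmid bound is carried to infinite volume along
boxes by the tier-2 boundary decay at rate `t > 0`. [folklore] -/
theorem dlrS_sum_abs_sub_integral_ge_le (htpos : 0 < t) (s : Finset ι)
    {F : ι → LGConfig d (Matrix.specialUnitaryGroup (Fin N) ℂ) → ℝ} {Δ : ι → Finset (ZdEdge d)} {K : ι → ℝ≥0}
    (hF : ∀ i ∈ s, IsLipschitzCylinder (fundamentalRep (Fin N)) (F i) (Δ i) (K i)) {Vc : ℝ}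
    (hV : ∀ n, ∑ y ∈ boxLinks d n, (∑ i ∈ s, 2 * Real.sqrt N * K i * ∑ z ∈ Δ i, exp (-(t * ‖z.1 - y.1‖))) ^ 2 ≤ Vc)
    {μ : Measure (LGConfig d (Matrix.specialUnitaryGroup (Fin N) ℂ))}
    (hμ : μ ∈ perturbedGibbsMeasuresS (d := d) (fundamentalRep (Fin N)) (N * β) W) {r : ℝ} (hr : 0 ≤ r) :
    μ.real {U | r ≤ |(∑ i ∈ s, F i U) - ∫ U', ∑ i ∈ s, F i U' ∂μ|} ≤ 2 * exp (-2 * r ^ 2 / Vc) := by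
  classical
  haveI : SecondCountableTopology (Matrix (Fin N) (Fin N) ℂ) :=
    inferInstanceAs (SecondCountableTopology (Fin N → Fin N → ℂ))
  haveI : SecondCountableTopology (Matrix.specialUnitaryGroup (Fin N) ℂ) :=
    Topology.IsEmbedding.subtypeVal.secondCountableTopology
  have hγ : IsSpecification (perturbedYMS (d := d) (fundamentalRep (Fin N)) (N * β) W) :=
    isSpecification_perturbedYMS _ (continuous_fundamentalRep (Fin N)) _ h hWc hWdep
  have hμ' : IsGibbsMeasure (perturbedYMS (d := d) (fundamentalRep (Fin N)) (N * β) W) μ := hμ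
  obtain ⟨hm, hM⟩ := measurable_sum_of_isLipschitzCylinder s hF
  -- a common box for the supports
  obtain ⟨m, hm'⟩ : ∃ m : ℕ, ∀ i ∈ s, Δ i ⊆ boxLinks d m := by
    rcases (s.biUnion Δ).eq_empty_or_nonempty with h0 | hne
    · refine ⟨0, fun i hi e he => ?_⟩
      have : e ∈ s.biUnion Δ := Finset.mem_biUnion.2 ⟨i, hi, he⟩
      rw [h0] at this
      exact absurd this (Finset.notMem_empty e)
    · refine ⟨⌈(s.biUnion Δ).sup' hne (fun e => ‖e.1‖)⌉₊, fun i hi e he => ?_⟩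
      rw [mem_boxLinks, mem_siteBox_iff_norm]
      exact (Finset.le_sup' (fun e : ZdEdge d => ‖e.1‖) (Finset.mem_biUnion.2 ⟨i, hi, he⟩)).trans (Nat.le_ceil _)
  have hrate : Tendsto (fun n : ℕ => (∑ i ∈ s, 2 * Real.sqrt N * K i * (Δ i).card) * exp (-(t * ((n : ℝ) - m))))
      atTop (𝓝 0) := by
    have h1 : Tendsto (fun n : ℕ => -(t * ((n : ℝ) - m))) atTop atBot := by
      have h2 : Tendsto (fun n : ℕ => t * ((n : ℝ) - m)) atTop atTop :=
        Tendsto.const_mul_atTop htpos (tendsto_atTop_add_const_right _ _ tendsto_natCast_atTop_atTop)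
      exact tendsto_neg_atTop_atBot.comp h2
    simpa using (Real.tendsto_exp_atBot.comp h1).const_mul (∑ i ∈ s, 2 * Real.sqrt N * K i * (Δ i).card)
  exact SpecConcentration.measureReal_abs_sub_integral_ge_le_of_tendsto hγ hm hM
    (c := fun y => ∑ i ∈ s, 2 * Real.sqrt N * K i * ∑ z ∈ Δ i, exp (-(t * ‖z.1 - y.1‖)))
    (fun y => Finset.sum_nonneg fun i _ => by
      have hK : (0 : ℝ) ≤ K i := (K i).2
      exact mul_nonneg (by positivity) (Finset.sum_nonneg fun z _ => (exp_pos _).le))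
    (fun Λ' y hy ω η' hωη => abs_kernelS_sub_kernelS_sum_le hd hN hc hv hb hP hVB h hWc hWdep hosc hoscs hosca hlip hlips hℓ ht
      hℓs hℓt hρ Λ' hy hωη s hF)
    (fun n => boxLinks d n) hV hμ'
    (fun n ω => abs_boxS_sum_sub_integral_le hd hN hc hv hb hP hVB h hWc hWdep hosc hoscs hosca hlip hlips hℓ ht hℓs hℓt hρ s hF
      hm' n hμ ω)
    hrate hr

end SUN

end Summit.Ventures.YMGap.RobustBall

end
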